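/-
Copyright (c) 2026 the pub-hodgecm-mathlib formalisation cell (harness21).  Prover seat hodgecm-mathlib-F0P2-p01 (g11), programme P2,
row B‴ «THE THETA INTERTWINER IN FUNCTION CURRENCY» for the desk's OCC♭-GEN line (`F0/P2/F0_P2OccFlatGeneral.prewrite.ed1.F0P2-plan-g12.lean`,
stub Θ-OCC-GEN `StubThetaOccursInGen`), 2026-09-01.  KERNEL module: THEOREMS ONLY (no definition, no named fact, no `sorry`, no instance, no notation).
-/
import Literature.NumberTheory.Automorphic.Liu2021.ThetaLiftFromLineCoinvariantJunction
import Literature.NumberTheory.Automorphic.Liu2021.ThetaLiftFromLinePureTensor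
import HarnessLib

/-!
# FLOOR-0 P2 · B‴ «THE THETA INTERTWINER IN FUNCTION CURRENCY»: `θ_{Φ_∞} : ω(μ, ε_a, χ)_f = omegaAtLine … a χ →ₗ[ℂ] (U(H)(𝔸_{L⁺}) → ℂ²)`,
# `θ (mk Φ_f) = (Θ̃_{R_e E(φ₀ ⊗ Φ_f)}(charCM χ̃_χ) ∘ ιA, Θ̃_{R_e E(φ₁ ⊗ Φ_f)}(charCM χ̃_χ) ∘ ιA)`, intertwining `ρ(a,χ)` with RIGHT TRANSLATION

Cell hodgecm-mathlib (D-0151), FLOOR 0; crux item H413 = stmt-HodgeConjecture-24833 (route `HCCMUnconditional`, no route verbs); programme P2,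
the OCC♭-GEN pay-down line of OCC♭∀ (`Cruxes/H413/Lines/F0_P2E3RelSign.lean` ED. 2 :240 `StubOccFlatAdmissibleAll`, books #155′): desk F0P2-plan
(g12)'s ED. 1 prewrite `F0/P2/F0_P2OccFlatGeneral.prewrite.ed1.F0P2-plan-g12.lean` (cd5892c01afc2355) cuts ONE letter Θ-OCC-GEN `StubThetaOccursInGen`
in FUNCTION currency: «`⟨a⟩` `μ`-admissible ⇒ ∃ θ : omegaAtLine … a χ →ₗ[ℂ] (U(H)(𝔸_{L⁺}) → ℂ²), θ ≠ 0, values in `cohForms (cmArchSection, cmCompactFactor)`,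
`θ (ρ(a,χ) k w) = fun x ↦ θ w (x * finAdelicToAdelic k)`».  THIS FILE supplies the θ: it is the χ-coinvariant descent of the PAIR OF GLOBAL THETA LIFTS
`Φ_f ↦ (x ↦ Θ̃_{R_e E(φ_j ⊗ Φ_f)}(charCM χ̃_χ)(ιA x))_{j=0,1}` for two archimedean Schwartz factors `φ₀, φ₁` — the FUNCTION-level twin of the `L²`-class
intertwiner ★ `Liu2021.exists_intertwiningMap_rhoAtLine_finRep` (node B, ★ `ThetaLiftFromLineFinIntertwiner`).  THEOREMS ONLY; `--supports stmt-HodgeConjecture-24833`.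
HONEST LABEL: HC_CM is proved only modulo the printed citations until rung 0 closes; this file closes NO print letter and asserts nothing of
[Liu2021] — it reduces Θ-OCC-GEN to «some theta pair of `(a, χ)` is cohomological-cotangent for every `Φ_f` and non-zero for one `Φ_f`».

## What is proved (any rank `N`; frame `(L, H, e₁, dV, hdV, hdV0, g, hg)`, line `a`, conjugate-symplectic `μ`, Weil majorants `hρ`, finite invariant
## measure `μW` on `[U(⟨a⟩)]`, `[U(diag dV)]` compact — an instance binder, ★ `Liu2021.compactSpace_quotient_diagonalFrame` in the CM frame)
* §1 pointwise identities ON THE GROUP for `Θ(φ, Φ_f)(x) := Θ̃_{R_e E(φ ⊗ Φ_f)}(f)(ιA x)` (`ιA = cmAdelicFrameTransport`, `R_e E = piSBReindex e₁ ∘ piSchwartzBruhatEquiv`):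
  `lineThetaLiftFun_transport_eq_toQuotFun` (dictionary with the descended function), `lineThetaLiftFun_tensor_add` ∕ `…_smul` (linearity in `Φ_f`,
  ★ `toQuotFun_lineThetaLift_add_left` ∕ `…_smul_left`), `lineThetaLiftFun_tensor_finPairRep_one` (`χ_W`-covariance: `Θ(φ, ω_f(1,u)Φ_f)(χ̃) = χ_W(u)·Θ(φ, Φ_f)(χ̃)`,
  ★ `lineThetaLiftFun_pairRep_one_charCM` + ★ `pairRep_finPairToAdelic_piSBReindex_tmul` + ★ `coe_chiQuot_mk_finAdelicToAdelic`),
  `lineThetaLiftFun_tensor_transport_mul_right` (`Θ(φ, Φ_f)(x · k_𝔸) = Θ(φ, ω_f(ιV k, 1)Φ_f)(x)`, ★ `lineThetaLiftFun_transport_mul_right`).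
* §2 **`exists_thetaFunIntertwiner_rhoAtLine`** — for `φ : Fin 2 → 𝓢` and `χ ∈ Chi`: `∃ θ : omegaAtLine … a χ →ₗ[ℂ] (U(H)(𝔸_{L⁺}) → ℂ²)` with
  `θ (mk Φ_f) = fun x j ↦ Θ(φ j, Φ_f)(charCM χ̃_χ)(x)` and `θ (rhoAtLine … ιV a χ k w) = fun x ↦ θ w (x * finAdelicToAdelic k)` (canonical `ιV`; ★
  `WeilCoinv.weilCoinvLift`).
SEQUEL (`Theorems/F0P2sThetaOccursInOfPairs.lean`, the 400-line rule): the pinned-`ιV` form `…_of_coe` and the `∃ θ`-clause of Θ-OCC-GEN at the frame from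
(T∀) «every theta pair lies in `A`» + (N) «one theta pair ≠ 0» (`exists_ne_zero_forall_mem_thetaFunIntertwiner{,_of_coe}`).

## References
* [Liu2021] Y. Liu, *Fourier–Jacobi cycles and arithmetic relative trace formula*, Camb. J. Math. 9 (2021) = arXiv:2102.11518, proof of Prop. 4.13
  (Case 1 l. 2131–2137; «Conversely» l. 2145–2149); Def. 4.11 (l. 2090–2096); App. D §D.1 Step 3 (l. 5219–5221).
* [Rallis1984] S. Rallis, *On the Howe duality conjecture*, Compositio Math. 51 (1984), proof of Thm. 1.2.2 p. 356.
* [GelbartRogawski1991] S. Gelbart, J. Rogawski, Invent. Math. 105 (1991), §3.1 Prop. 3.1.1, §3.2 p. 457.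
* [FleigEtAl2018] P. Fleig, H. Gustafsson, A. Kleinschmidt, D. Persson, CUP (2018), §12.3 Def. 12.5 (12.37) p. 296.
* [Weil1964] A. Weil, Acta Math. 111 (1964), Chap. III n° 37–38, n° 41 Thm 6.
* [BorelJacquet1979] A. Borel, H. Jacquet, PSPM 33.1 (1979), §4.1, §4.6.
-/

set_option autoImplicit false

-- the mandated namespace has the single-problem summit's repeated segment (`HodgeConjecture.HodgeConjecture`)
set_option linter.dupNamespace false

noncomputable section

open NumberField MeasureTheory IsDedekindDomain
open scoped Matrix Kronecker ComplexOrder ENNReal SchwartzMap TensorProduct Classical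

namespace Summit.HodgeConjecture.HodgeConjecture.Cruxes.H413.F0P2sThetaFunIntertwiner

open Literature.NumberTheory.Automorphic Literature.NumberTheory.Automorphic.UnitaryGroup
open Literature.NumberTheory.Automorphic.UnitaryGroup.CotangentForms
open Literature.NumberTheory.Automorphic.IdeleClassGroup
open Literature.NumberTheory.Automorphic.Liu2021
open Literature.NumberTheory.Automorphic.Liu2021.Def411WeilCarriers
open Literature.NumberTheory.Automorphic.Liu2021.Def411WeilCarriersDoubling
open Literature.NumberTheory.GelbartRogawski1991 Literature.NumberTheory.GelbartRogawski1991.UnitaryDualPair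
open Literature.NumberTheory.GelbartRogawski1991.UnitaryDualPair.WeilCoinv
open Literature.NumberTheory.Weil1964
open Literature.RepresentationTheory Literature.RepresentationTheory.Liu2021
open Literature.RepresentationTheory.CompactGroups

variable (L : Type) [Field L] [NumberField L] [IsCMField L] (N : ℕ) (H : Matrix (Fin N) (Fin N) L)
  {n' : ℕ} (e₁ : Fin N × Fin 1 ≃ Fin n') (dV : Fin N → L) (hdV : ∀ i, IsCMField.complexConj L (dV i) = dV i)
  (hdV0 : ∀ i, dV i ≠ 0) (g : GL (Fin N) L)
  (hg : ((g : Matrix (Fin N) (Fin N) L).map (cmConjRingHom L))ᵀ * H * (g : Matrix (Fin N) (Fin N) L) = Matrix.diagonal dV)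
  (μ : Literature.NumberTheory.Automorphic.IdeleClassGroup L →ₜ* Circle) (hμ : IsConjugateSymplectic L μ) (a : (↥(maximalRealSubfield L))ˣ)
  (hρ : HasThetaMajorants fun
      (p : ↥(UnitaryGroup.adelic (↥(maximalRealSubfield L)) L (IsCMField.complexConj L) N (Matrix.diagonal dV)) × ↥(UnitaryGroup.adelic (↥(maximalRealSubfield L)) L (IsCMField.complexConj L) 1 (JW (↥(maximalRealSubfield L)) L a))) (Φ : piSchwartzBruhat (↥(maximalRealSubfield L)) (Fin n')) =>
        pairRep (↥(maximalRealSubfield L)) L (IsCMField.complexConj L) N 1 e₁ (Matrix.diagonal dV) (JW (↥(maximalRealSubfield L)) L a)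
          (chiSplittingLine L e₁ dV hdV hdV0 (toHeckeCharacter L μ) (isUnitary_toHeckeCharacter L μ)
            ((isOscillatorChar_toHeckeCharacter_iff μ).mpr hμ) (TW (↥(maximalRealSubfield L)) a)
            (isUnit_det_TW (↥(maximalRealSubfield L)) a) (JW (↥(maximalRealSubfield L)) L a) (JW_eq (↥(maximalRealSubfield L)) L a))
          p Φ)
  [CompactSpace (↥(UnitaryGroup.adelic (↥(maximalRealSubfield L)) L (IsCMField.complexConj L) N (Matrix.diagonal dV)) ⧸ (UnitaryGroup.toAdelic (↥(maximalRealSubfield L)) L (IsCMField.complexConj L) N (Matrix.diagonal dV)).range)] [MeasurableSpace (↥(UnitaryGroup.adelic (↥(maximalRealSubfield L)) L (IsCMField.complexConj L) 1 (JW (↥(maximalRealSubfield L)) L a)) ⧸ (UnitaryGroup.toAdelic (↥(maximalRealSubfield L)) L (IsCMField.complexConj L) 1 (JW (↥(maximalRealSubfield L)) L a)).range)] [BorelSpace (↥(UnitaryGroup.adelic (↥(maximalRealSubfield L)) L (IsCMField.complexConj L) 1 (JW (↥(maximalRealSubfield L)) L a)) ⧸ (UnitaryGroup.toAdelic (↥(maximalRealSubfield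 L)) L (IsCMField.complexConj L) 1 (JW (↥(maximalRealSubfield L)) L a)).range)] (μW : Measure (↥(UnitaryGroup.adelic (↥(maximalRealSubfield L)) L (IsCMField.complexConj L) 1 (JW (↥(maximalRealSubfield L)) L a)) ⧸ (UnitaryGroup.toAdelic (↥(maximalRealSubfield L)) L (IsCMField.complexConj L) 1 (JW (↥(maximalRealSubfield L)) L a)).range)) [IsFiniteMeasure μW]

/-! ## §1 Pointwise identities on the group for `x ↦ Θ̃_{R_e E(φ ⊗ Φ_f)}(f)(ιA x)` -/

omit [BorelSpace (↥(UnitaryGroup.adelic (↥(maximalRealSubfield L)) L (IsCMField.complexConj L) 1 (JW (↥(maximalRealSubfield L)) L a)) ⧸ (UnitaryGroup.toAdelic (↥(maximalRealSubfield L)) L (IsCMField.complexConj L) 1 (JW (↥(maximalRealSubfield L)) L a)).range)] [IsFiniteMeasure μW] in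
/-- **Dictionary with the descended function**: `Θ̃_Φ(f)(ιA y) = toQuotFun (Θ̃_Φ(f) ∘ ιA) [y⁻¹]` (`toQuotFun F [g] = F(g⁻¹)`, ★ `toQuotFun_lineThetaLift_mk`).
[cite: BorelJacquet1979, §4.2] -/
theorem lineThetaLiftFun_transport_eq_toQuotFun (Φ : piSchwartzBruhat (↥(maximalRealSubfield L)) (Fin n'))
    (f : C((↥(UnitaryGroup.adelic (↥(maximalRealSubfield L)) L (IsCMField.complexConj L) 1 (JW (↥(maximalRealSubfield L)) L a)) ⧸ (UnitaryGroup.toAdelic (↥(maximalRealSubfield L)) L (IsCMField.complexConj L) 1 (JW (↥(maximalRealSubfield L)) L a)).range), ℂ))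
    (y : (adelicGroupData (↥(maximalRealSubfield L)) L (IsCMField.complexConj L) N H).Adelic) :
    (lineThetaKernelDatum L N e₁ dV hdV hdV0 μ hμ a hρ).thetaLiftFun μW Φ f ((cmAdelicFrameTransport L N H dV g hg) y) =
      toQuotFun (adelicGroupData (↥(maximalRealSubfield L)) L (IsCMField.complexConj L) N H)
        (fun y' => (lineThetaKernelDatum L N e₁ dV hdV hdV0 μ hμ a hρ).thetaLiftFun μW Φ f ((cmAdelicFrameTransport L N H dV g hg) y'))
        ((adelicGroupData (↥(maximalRealSubfield L)) L (IsCMField.complexConj L) N H).toAutomorphicQuotient y⁻¹) := by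
  rw [toQuotFun_lineThetaLift_mk L N H e₁ dV hdV hdV0 g hg μ hμ a hρ μW Φ f, ThetaKernelDatum.thetaLiftFun_apply, map_inv]

/-- **Additivity in the finite factor, pointwise**: `Θ̃_{R_e E(φ ⊗ (Φ_f + Φ_f'))}(f)(ιA y) = Θ̃_{R_e E(φ ⊗ Φ_f)}(f)(ιA y) + Θ̃_{R_e E(φ ⊗ Φ_f')}(f)(ιA y)`
(bilinearity of `⊗`, linearity of `R_e E`, ★ `toQuotFun_lineThetaLift_add_left`). [cite: Weil1964, Chap. III n° 41 Thm 6 p. 193] -/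
theorem lineThetaLiftFun_tensor_add
    (f : C((↥(UnitaryGroup.adelic (↥(maximalRealSubfield L)) L (IsCMField.complexConj L) 1 (JW (↥(maximalRealSubfield L)) L a)) ⧸ (UnitaryGroup.toAdelic (↥(maximalRealSubfield L)) L (IsCMField.complexConj L) 1 (JW (↥(maximalRealSubfield L)) L a)).range), ℂ))
    (φ : 𝓢(((Fin N × Fin 1) → NumberField.mixedEmbedding.mixedSpace ↥(maximalRealSubfield L)), ℂ))
    (Φf Φf' : FinSB (↥(maximalRealSubfield L)) (Fin N × Fin 1))
    (y : (adelicGroupData (↥(maximalRealSubfield L)) L (IsCMField.complexConj L) N H).Adelic) :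
    (lineThetaKernelDatum L N e₁ dV hdV hdV0 μ hμ a hρ).thetaLiftFun μW
        (piSBReindex (↥(maximalRealSubfield L)) e₁ (piSchwartzBruhatEquiv (↥(maximalRealSubfield L)) (Fin N × Fin 1) (φ ⊗ₜ[ℂ] (Φf + Φf'))))
        f ((cmAdelicFrameTransport L N H dV g hg) y) =
      (lineThetaKernelDatum L N e₁ dV hdV hdV0 μ hμ a hρ).thetaLiftFun μW
          (piSBReindex (↥(maximalRealSubfield L)) e₁ (piSchwartzBruhatEquiv (↥(maximalRealSubfield L)) (Fin N × Fin 1) (φ ⊗ₜ[ℂ] Φf)))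
          f ((cmAdelicFrameTransport L N H dV g hg) y) +
        (lineThetaKernelDatum L N e₁ dV hdV hdV0 μ hμ a hρ).thetaLiftFun μW
          (piSBReindex (↥(maximalRealSubfield L)) e₁ (piSchwartzBruhatEquiv (↥(maximalRealSubfield L)) (Fin N × Fin 1) (φ ⊗ₜ[ℂ] Φf')))
          f ((cmAdelicFrameTransport L N H dV g hg) y) := by
  rw [TensorProduct.tmul_add, map_add, map_add, lineThetaLiftFun_transport_eq_toQuotFun L N H e₁ dV hdV hdV0 g hg μ hμ a hρ μW,
    lineThetaLiftFun_transport_eq_toQuotFun L N H e₁ dV hdV hdV0 g hg μ hμ a hρ μW,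
    lineThetaLiftFun_transport_eq_toQuotFun L N H e₁ dV hdV hdV0 g hg μ hμ a hρ μW,
    toQuotFun_lineThetaLift_add_left L N H e₁ dV hdV hdV0 g hg μ hμ a hρ μW f, Pi.add_apply]

omit [BorelSpace (↥(UnitaryGroup.adelic (↥(maximalRealSubfield L)) L (IsCMField.complexConj L) 1 (JW (↥(maximalRealSubfield L)) L a)) ⧸ (UnitaryGroup.toAdelic (↥(maximalRealSubfield L)) L (IsCMField.complexConj L) 1 (JW (↥(maximalRealSubfield L)) L a)).range)] [IsFiniteMeasure μW] in
/-- **Homogeneity in the finite factor, pointwise**: `Θ̃_{R_e E(φ ⊗ c•Φ_f)}(f)(ιA y) = c · Θ̃_{R_e E(φ ⊗ Φ_f)}(f)(ιA y)` (★ `toQuotFun_lineThetaLift_smul_left`).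
[cite: Weil1964, Chap. III n° 41 Thm 6 p. 193] -/
theorem lineThetaLiftFun_tensor_smul
    (f : C((↥(UnitaryGroup.adelic (↥(maximalRealSubfield L)) L (IsCMField.complexConj L) 1 (JW (↥(maximalRealSubfield L)) L a)) ⧸ (UnitaryGroup.toAdelic (↥(maximalRealSubfield L)) L (IsCMField.complexConj L) 1 (JW (↥(maximalRealSubfield L)) L a)).range), ℂ))
    (φ : 𝓢(((Fin N × Fin 1) → NumberField.mixedEmbedding.mixedSpace ↥(maximalRealSubfield L)), ℂ)) (c : ℂ)
    (Φf : FinSB (↥(maximalRealSubfield L)) (Fin N × Fin 1))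
    (y : (adelicGroupData (↥(maximalRealSubfield L)) L (IsCMField.complexConj L) N H).Adelic) :
    (lineThetaKernelDatum L N e₁ dV hdV hdV0 μ hμ a hρ).thetaLiftFun μW
        (piSBReindex (↥(maximalRealSubfield L)) e₁ (piSchwartzBruhatEquiv (↥(maximalRealSubfield L)) (Fin N × Fin 1) (φ ⊗ₜ[ℂ] (c • Φf))))
        f ((cmAdelicFrameTransport L N H dV g hg) y) =
      c * (lineThetaKernelDatum L N e₁ dV hdV hdV0 μ hμ a hρ).thetaLiftFun μW
          (piSBReindex (↥(maximalRealSubfield L)) e₁ (piSchwartzBruhatEquiv (↥(maximalRealSubfield L)) (Fin N × Fin 1) (φ ⊗ₜ[ℂ] Φf)))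
          f ((cmAdelicFrameTransport L N H dV g hg) y) := by
  rw [TensorProduct.tmul_smul, map_smul, map_smul, lineThetaLiftFun_transport_eq_toQuotFun L N H e₁ dV hdV hdV0 g hg μ hμ a hρ μW,
    lineThetaLiftFun_transport_eq_toQuotFun L N H e₁ dV hdV hdV0 g hg μ hμ a hρ μW,
    toQuotFun_lineThetaLift_smul_left L N H e₁ dV hdV hdV0 g hg μ hμ a hρ μW f, Pi.smul_apply, smul_eq_mul]

/-- **Right translation by `U(H)(𝔸_{L⁺,f})` in the finite factor, pointwise**: `Θ̃_{R_e E(φ ⊗ Φ_f)}(f)(ιA (x · k_𝔸)) = Θ̃_{R_e E(φ ⊗ ω_f(ιV k, 1) Φ_f)}(f)(ιA x)`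
for the canonical finite transport `ιV k = (ιA k_𝔸)_f` (★ `lineThetaLiftFun_transport_mul_right`, `(ιA k_𝔸, 1) = finPairToAdelic (ιV k, 1)` ★
`cmAdelicFrameTransport_finAdelicToAdelic`, `arch ⊗ fin` factorisation ★ `pairRep_finPairToAdelic_piSBReindex_tmul`).
[cite: FleigEtAl2018, §12.3 Def. 12.5 (12.37) p. 296] [cite: Weil1964, Chap. III n° 37–38 p. 188–190] [cite: BorelJacquet1979, §4.1] -/
theorem lineThetaLiftFun_tensor_transport_mul_right
    (f : C((↥(UnitaryGroup.adelic (↥(maximalRealSubfield L)) L (IsCMField.complexConj L) 1 (JW (↥(maximalRealSubfield L)) L a)) ⧸ (UnitaryGroup.toAdelic (↥(maximalRealSubfield L)) L (IsCMField.complexConj L) 1 (JW (↥(maximalRealSubfield L)) L a)).range), ℂ))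
    (φ : 𝓢(((Fin N × Fin 1) → NumberField.mixedEmbedding.mixedSpace ↥(maximalRealSubfield L)), ℂ))
    (Φf : FinSB (↥(maximalRealSubfield L)) (Fin N × Fin 1))
    (x : (adelicGroupData (↥(maximalRealSubfield L)) L (IsCMField.complexConj L) N H).Adelic)
    (k : finAdelic (↥(maximalRealSubfield L)) L (IsCMField.complexConj L) N H) :
    (lineThetaKernelDatum L N e₁ dV hdV hdV0 μ hμ a hρ).thetaLiftFun μW
        (piSBReindex (↥(maximalRealSubfield L)) e₁ (piSchwartzBruhatEquiv (↥(maximalRealSubfield L)) (Fin N × Fin 1) (φ ⊗ₜ[ℂ] Φf)))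
        f ((cmAdelicFrameTransport L N H dV g hg) (x * finAdelicToAdelic (↥(maximalRealSubfield L)) L (IsCMField.complexConj L) N H k)) =
      (lineThetaKernelDatum L N e₁ dV hdV hdV0 μ hμ a hρ).thetaLiftFun μW
        (piSBReindex (↥(maximalRealSubfield L)) e₁ (piSchwartzBruhatEquiv (↥(maximalRealSubfield L)) (Fin N × Fin 1)
          (φ ⊗ₜ[ℂ] finPairRep (↥(maximalRealSubfield L)) L (IsCMField.complexConj L) N 1 e₁ (Matrix.diagonal dV) (JW (↥(maximalRealSubfield L)) L a)
            (complexConj_imagUnit L) (imagUnit_ne_zero L) (imagUnit_mul_self L) (realDiagonal_isSymm L dV hdV) (isSymm_TW (↥(maximalRealSubfield L)) a)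
            (isUnit_det_realDiagonal L dV hdV hdV0) (isUnit_det_TW (↥(maximalRealSubfield L)) a) (realDiagonal_map L dV hdV).symm
            (JW_eq (↥(maximalRealSubfield L)) L a)
            (isCompatible_chiSplittingLine L e₁ dV hdV hdV0 (toHeckeCharacter L μ) (isUnitary_toHeckeCharacter L μ)
              ((isOscillatorChar_toHeckeCharacter_iff μ).mpr hμ) (TW (↥(maximalRealSubfield L)) a) (isSymm_TW (↥(maximalRealSubfield L)) a)
              (isUnit_det_TW (↥(maximalRealSubfield L)) a) (JW (↥(maximalRealSubfield L)) L a) (JW_eq (↥(maximalRealSubfield L)) L a))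
            ((finPart (↥(maximalRealSubfield L)) L (IsCMField.complexConj L) N (Matrix.diagonal dV)
              (cmAdelicFrameTransport L N H dV g hg (finAdelicToAdelic (↥(maximalRealSubfield L)) L (IsCMField.complexConj L) N H k))), 1) Φf)))
        f ((cmAdelicFrameTransport L N H dV g hg) x) := by
  rw [lineThetaLiftFun_transport_mul_right L N H e₁ dV hdV hdV0 g hg μ hμ a hρ μW _ f]
  -- `(ιA k_𝔸, 1) = finPairToAdelic (ιV k, 1)` in the adelic dual pair, then the `arch ⊗ fin` factorisation of `ω`
  have hp : ((cmAdelicFrameTransport L N H dV g hg) (finAdelicToAdelic (↥(maximalRealSubfield L)) L (IsCMField.complexConj L) N H k),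
        (1 : ↥(UnitaryGroup.adelic (↥(maximalRealSubfield L)) L (IsCMField.complexConj L) 1 (JW (↥(maximalRealSubfield L)) L a)))) =
      finPairToAdelic (↥(maximalRealSubfield L)) L (IsCMField.complexConj L) N 1 (Matrix.diagonal dV) (JW (↥(maximalRealSubfield L)) L a)
        ((finPart (↥(maximalRealSubfield L)) L (IsCMField.complexConj L) N (Matrix.diagonal dV)
          (cmAdelicFrameTransport L N H dV g hg (finAdelicToAdelic (↥(maximalRealSubfield L)) L (IsCMField.complexConj L) N H k))), 1) :=
    Prod.ext (cmAdelicFrameTransport_finAdelicToAdelic L N H dV g hg k)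
      (by rw [finPairToAdelic_apply, map_one]; rfl)
  rw [hp, pairRep_finPairToAdelic_piSBReindex_tmul (↥(maximalRealSubfield L)) L (IsCMField.complexConj L) N 1 e₁ (Matrix.diagonal dV)
    (JW (↥(maximalRealSubfield L)) L a) (complexConj_imagUnit L) (imagUnit_ne_zero L) (imagUnit_mul_self L) (realDiagonal_isSymm L dV hdV)
    (isSymm_TW (↥(maximalRealSubfield L)) a) (isUnit_det_realDiagonal L dV hdV hdV0) (isUnit_det_TW (↥(maximalRealSubfield L)) a)
    (realDiagonal_map L dV hdV).symm (JW_eq (↥(maximalRealSubfield L)) L a) _ _ φ Φf]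

variable [SMulInvariantMeasure ↥(UnitaryGroup.adelic (↥(maximalRealSubfield L)) L (IsCMField.complexConj L) 1 (JW (↥(maximalRealSubfield L)) L a)) (↥(UnitaryGroup.adelic (↥(maximalRealSubfield L)) L (IsCMField.complexConj L) 1 (JW (↥(maximalRealSubfield L)) L a)) ⧸ (UnitaryGroup.toAdelic (↥(maximalRealSubfield L)) L (IsCMField.complexConj L) 1 (JW (↥(maximalRealSubfield L)) L a)).range) μW]

/-- **`χ_W`-covariance in the finite factor, pointwise**: `Θ̃_{R_e E(φ ⊗ ω_f(1,u)Φ_f)}(charCM χ̃_χ)(ιA x) = χ_W(u) · Θ̃_{R_e E(φ ⊗ Φ_f)}(charCM χ̃_χ)(ιA x)` for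
`u ∈ U(⟨a⟩)(𝔸_{L⁺,f})`, `χ̃_χ = chiQuot a χ` (trivial at `∞`, finite part `χ_W = lineChar a χ.1`): ★ `lineThetaLiftFun_pairRep_one_charCM` at `h = u_𝔸` after the
`arch ⊗ fin` factorisation, and ★ `coe_chiQuot_mk_finAdelicToAdelic` — the map `Φ_f ↦ Θ(φ, Φ_f)(charCM χ̃_χ)` kills the relation module of the `χ_W`-coinvariants
`omegaAtLine … a χ`. [cite: Liu2021, App. D §D.1 Step 3 (l. 5221)] [cite: GelbartRogawski1991, §3.2 p. 457] -/
theorem lineThetaLiftFun_tensor_finPairRep_one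
    (φ : 𝓢(((Fin N × Fin 1) → NumberField.mixedEmbedding.mixedSpace ↥(maximalRealSubfield L)), ℂ))
    (χ : Chi (↥(maximalRealSubfield L)) L (IsCMField.complexConj L))
    (u : finAdelic (↥(maximalRealSubfield L)) L (IsCMField.complexConj L) 1 (JW (↥(maximalRealSubfield L)) L a))
    (Φf : FinSB (↥(maximalRealSubfield L)) (Fin N × Fin 1))
    (x : (adelicGroupData (↥(maximalRealSubfield L)) L (IsCMField.complexConj L) N H).Adelic) :
    haveI := normal_range_toAdelic_JW L a
    (lineThetaKernelDatum L N e₁ dV hdV hdV0 μ hμ a hρ).thetaLiftFun μW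
        (piSBReindex (↥(maximalRealSubfield L)) e₁ (piSchwartzBruhatEquiv (↥(maximalRealSubfield L)) (Fin N × Fin 1)
          (φ ⊗ₜ[ℂ] finPairRep (↥(maximalRealSubfield L)) L (IsCMField.complexConj L) N 1 e₁ (Matrix.diagonal dV) (JW (↥(maximalRealSubfield L)) L a)
            (complexConj_imagUnit L) (imagUnit_ne_zero L) (imagUnit_mul_self L) (realDiagonal_isSymm L dV hdV) (isSymm_TW (↥(maximalRealSubfield L)) a)
            (isUnit_det_realDiagonal L dV hdV hdV0) (isUnit_det_TW (↥(maximalRealSubfield L)) a) (realDiagonal_map L dV hdV).symm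
            (JW_eq (↥(maximalRealSubfield L)) L a)
            (isCompatible_chiSplittingLine L e₁ dV hdV hdV0 (toHeckeCharacter L μ) (isUnitary_toHeckeCharacter L μ)
              ((isOscillatorChar_toHeckeCharacter_iff μ).mpr hμ) (TW (↥(maximalRealSubfield L)) a) (isSymm_TW (↥(maximalRealSubfield L)) a)
              (isUnit_det_TW (↥(maximalRealSubfield L)) a) (JW (↥(maximalRealSubfield L)) L a) (JW_eq (↥(maximalRealSubfield L)) L a))
            (1, u) Φf)))
        (charCM (chiQuot (↥(maximalRealSubfield L)) L (IsCMField.complexConj L) (Algebra.IsQuadraticExtension.finrank_eq_two _ L)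
          (IsCMField.complexConj_ne_one (K := L)) a χ))
        ((cmAdelicFrameTransport L N H dV g hg) x) =
      ((lineChar (↥(maximalRealSubfield L)) L (IsCMField.complexConj L) a χ.1 u : ℂˣ) : ℂ) *
        (lineThetaKernelDatum L N e₁ dV hdV hdV0 μ hμ a hρ).thetaLiftFun μW
          (piSBReindex (↥(maximalRealSubfield L)) e₁ (piSchwartzBruhatEquiv (↥(maximalRealSubfield L)) (Fin N × Fin 1) (φ ⊗ₜ[ℂ] Φf)))
          (charCM (chiQuot (↥(maximalRealSubfield L)) L (IsCMField.complexConj L) (Algebra.IsQuadraticExtension.finrank_eq_two _ L)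
            (IsCMField.complexConj_ne_one (K := L)) a χ))
          ((cmAdelicFrameTransport L N H dV g hg) x) := by
  haveI := normal_range_toAdelic_JW L a
  -- `((1, u_𝔸) : adelic pair) = finPairToAdelic (1, u)`
  have hp : ((1, finAdelicToAdelic (↥(maximalRealSubfield L)) L (IsCMField.complexConj L) 1 (JW (↥(maximalRealSubfield L)) L a) u) :
        ↥(UnitaryGroup.adelic (↥(maximalRealSubfield L)) L (IsCMField.complexConj L) N (Matrix.diagonal dV)) ×
          ↥(UnitaryGroup.adelic (↥(maximalRealSubfield L)) L (IsCMField.complexConj L) 1 (JW (↥(maximalRealSubfield L)) L a))) =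
      finPairToAdelic (↥(maximalRealSubfield L)) L (IsCMField.complexConj L) N 1 (Matrix.diagonal dV) (JW (↥(maximalRealSubfield L)) L a) (1, u) := by
    simp only [finPairToAdelic_apply, map_one]
    rfl
  have hΨ : piSBReindex (↥(maximalRealSubfield L)) e₁ (piSchwartzBruhatEquiv (↥(maximalRealSubfield L)) (Fin N × Fin 1)
        (φ ⊗ₜ[ℂ] finPairRep (↥(maximalRealSubfield L)) L (IsCMField.complexConj L) N 1 e₁ (Matrix.diagonal dV) (JW (↥(maximalRealSubfield L)) L a)
          (complexConj_imagUnit L) (imagUnit_ne_zero L) (imagUnit_mul_self L) (realDiagonal_isSymm L dV hdV) (isSymm_TW (↥(maximalRealSubfield L)) a)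
          (isUnit_det_realDiagonal L dV hdV hdV0) (isUnit_det_TW (↥(maximalRealSubfield L)) a) (realDiagonal_map L dV hdV).symm
          (JW_eq (↥(maximalRealSubfield L)) L a)
          (isCompatible_chiSplittingLine L e₁ dV hdV hdV0 (toHeckeCharacter L μ) (isUnitary_toHeckeCharacter L μ)
            ((isOscillatorChar_toHeckeCharacter_iff μ).mpr hμ) (TW (↥(maximalRealSubfield L)) a) (isSymm_TW (↥(maximalRealSubfield L)) a)
            (isUnit_det_TW (↥(maximalRealSubfield L)) a) (JW (↥(maximalRealSubfield L)) L a) (JW_eq (↥(maximalRealSubfield L)) L a))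
          (1, u) Φf)) =
      pairRep (↥(maximalRealSubfield L)) L (IsCMField.complexConj L) N 1 e₁ (Matrix.diagonal dV) (JW (↥(maximalRealSubfield L)) L a)
        (chiSplittingLine L e₁ dV hdV hdV0 (toHeckeCharacter L μ) (isUnitary_toHeckeCharacter L μ)
          ((isOscillatorChar_toHeckeCharacter_iff μ).mpr hμ) (TW (↥(maximalRealSubfield L)) a)
          (isUnit_det_TW (↥(maximalRealSubfield L)) a) (JW (↥(maximalRealSubfield L)) L a) (JW_eq (↥(maximalRealSubfield L)) L a))
        ((1, finAdelicToAdelic (↥(maximalRealSubfield L)) L (IsCMField.complexConj L) 1 (JW (↥(maximalRealSubfield L)) L a) u) :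
          ↥(UnitaryGroup.adelic (↥(maximalRealSubfield L)) L (IsCMField.complexConj L) N (Matrix.diagonal dV)) ×
            ↥(UnitaryGroup.adelic (↥(maximalRealSubfield L)) L (IsCMField.complexConj L) 1 (JW (↥(maximalRealSubfield L)) L a)))
        (piSBReindex (↥(maximalRealSubfield L)) e₁ (piSchwartzBruhatEquiv (↥(maximalRealSubfield L)) (Fin N × Fin 1) (φ ⊗ₜ[ℂ] Φf))) := by
    rw [hp]
    exact (pairRep_finPairToAdelic_piSBReindex_tmul (↥(maximalRealSubfield L)) L (IsCMField.complexConj L) N 1 e₁ (Matrix.diagonal dV)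
      (JW (↥(maximalRealSubfield L)) L a) (complexConj_imagUnit L) (imagUnit_ne_zero L) (imagUnit_mul_self L) (realDiagonal_isSymm L dV hdV)
      (isSymm_TW (↥(maximalRealSubfield L)) a) (isUnit_det_realDiagonal L dV hdV hdV0) (isUnit_det_TW (↥(maximalRealSubfield L)) a)
      (realDiagonal_map L dV hdV).symm (JW_eq (↥(maximalRealSubfield L)) L a) _ _ φ Φf).symm
  rw [hΨ, lineThetaLiftFun_pairRep_one_charCM L N H e₁ dV hdV hdV0 g hg μ hμ a hρ μW _
    (finAdelicToAdelic (↥(maximalRealSubfield L)) L (IsCMField.complexConj L) 1 (JW (↥(maximalRealSubfield L)) L a) u)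
    (chiQuot (↥(maximalRealSubfield L)) L (IsCMField.complexConj L) (Algebra.IsQuadraticExtension.finrank_eq_two _ L)
      (IsCMField.complexConj_ne_one (K := L)) a χ) x,
    coe_chiQuot_mk_finAdelicToAdelic]

/-! ## §2 The theta intertwiner `θ_{φ} : omegaAtLine … a χ →ₗ[ℂ] (U(H)(𝔸_{L⁺}) → ℂ²)` in function currency -/

set_option maxHeartbeats 1600000 in
/-- **B‴ — THE THETA INTERTWINER IN FUNCTION CURRENCY (canonical `ιV`)** ([Rallis1984] localisation of the global theta lift; [Liu2021, App. D §D.1 Step 3]).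
For two archimedean Schwartz factors `φ₀, φ₁` and `χ ∈ Chi`, the `ℂ`-linear map `Φ_f ↦ (x ↦ Θ̃_{R_e E(φ_j ⊗ Φ_f)}(charCM χ̃_χ)(ιA x))_{j}` (§1: linear in `Φ_f`)
kills `ω_f(1,u)Φ_f − χ_W(u)Φ_f` (§1 `lineThetaLiftFun_tensor_finPairRep_one`), hence DESCENDS to the `χ_W`-coinvariants `omegaAtLine … a χ` (★ `weilCoinvLift`) —
BY DEFINITION the space of `ρ(a,χ) = rhoAtLine … ιV a χ` — and the descended `θ` intertwines `ρ(a,χ)` (canonical `ιV = finPart ∘ ιA ∘ finAdelicToAdelic`) with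
RIGHT TRANSLATION by `U(H)(𝔸_{L⁺,f})` (§1 `lineThetaLiftFun_tensor_transport_mul_right`): `θ (ρ(a,χ) k w) = fun x ↦ θ w (x * k_𝔸)`.
[cite: Liu2021, proof of Prop. 4.13 Case 1 (l. 2136–2137, p. 48); App. D §D.1 Step 3 (l. 5219–5221)] [cite: Rallis1984, Thm. 1.2.2 proof p. 356]
[cite: GelbartRogawski1991, §3.2 p. 457] [cite: BorelJacquet1979, §4.1] -/
theorem exists_thetaFunIntertwiner_rhoAtLine
    (φ : Fin 2 → 𝓢(((Fin N × Fin 1) → NumberField.mixedEmbedding.mixedSpace ↥(maximalRealSubfield L)), ℂ))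
    (χ : Chi (↥(maximalRealSubfield L)) L (IsCMField.complexConj L)) :
    haveI := normal_range_toAdelic_JW L a
    ∃ θ : omegaAtLine (↥(maximalRealSubfield L)) L (IsCMField.complexConj L) N e₁ (Matrix.diagonal dV)
          (complexConj_imagUnit L) (imagUnit_ne_zero L) (imagUnit_mul_self L) (realDiagonal_isSymm L dV hdV)
          (isUnit_det_realDiagonal L dV hdV hdV0) (realDiagonal_map L dV hdV).symm
          (fun b => isCompatible_chiSplittingLine L e₁ dV hdV hdV0 (toHeckeCharacter L μ)
            (isUnitary_toHeckeCharacter L μ) ((isOscillatorChar_toHeckeCharacter_iff μ).mpr hμ)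
            (TW (↥(maximalRealSubfield L)) b) (isSymm_TW (↥(maximalRealSubfield L)) b)
            (isUnit_det_TW (↥(maximalRealSubfield L)) b) (JW (↥(maximalRealSubfield L)) L b)
            (JW_eq (↥(maximalRealSubfield L)) L b)) a χ →ₗ[ℂ]
        ((adelicGroupData (↥(maximalRealSubfield L)) L (IsCMField.complexConj L) N H).Adelic → (Fin 2 → ℂ)),
      (∀ Φf : FinSB (↥(maximalRealSubfield L)) (Fin N × Fin 1),
          θ (TwistedCoinv.mk _ _ Φf) = fun x j =>
            (lineThetaKernelDatum L N e₁ dV hdV hdV0 μ hμ a hρ).thetaLiftFun μW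
              (piSBReindex (↥(maximalRealSubfield L)) e₁ (piSchwartzBruhatEquiv (↥(maximalRealSubfield L)) (Fin N × Fin 1) (φ j ⊗ₜ[ℂ] Φf)))
              (charCM (chiQuot (↥(maximalRealSubfield L)) L (IsCMField.complexConj L) (Algebra.IsQuadraticExtension.finrank_eq_two _ L)
                (IsCMField.complexConj_ne_one (K := L)) a χ))
              ((cmAdelicFrameTransport L N H dV g hg) x)) ∧
        ∀ (k : finAdelic (↥(maximalRealSubfield L)) L (IsCMField.complexConj L) N H) (w),
          θ (rhoAtLine (↥(maximalRealSubfield L)) L (IsCMField.complexConj L) N e₁ (Matrix.diagonal dV)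
              (complexConj_imagUnit L) (imagUnit_ne_zero L) (imagUnit_mul_self L) (realDiagonal_isSymm L dV hdV)
              (isUnit_det_realDiagonal L dV hdV hdV0) (realDiagonal_map L dV hdV).symm
              (fun b => isCompatible_chiSplittingLine L e₁ dV hdV hdV0 (toHeckeCharacter L μ)
                (isUnitary_toHeckeCharacter L μ) ((isOscillatorChar_toHeckeCharacter_iff μ).mpr hμ)
                (TW (↥(maximalRealSubfield L)) b) (isSymm_TW (↥(maximalRealSubfield L)) b)
                (isUnit_det_TW (↥(maximalRealSubfield L)) b) (JW (↥(maximalRealSubfield L)) L b)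
                (JW_eq (↥(maximalRealSubfield L)) L b))
              ((finPart (↥(maximalRealSubfield L)) L (IsCMField.complexConj L) N (Matrix.diagonal dV)).comp
                ((cmAdelicFrameTransport L N H dV g hg).comp (finAdelicToAdelic (↥(maximalRealSubfield L)) L (IsCMField.complexConj L) N H)))
              a χ k w) =
            fun x => θ w (x * finAdelicToAdelic (↥(maximalRealSubfield L)) L (IsCMField.complexConj L) N H k) := by
  haveI := normal_range_toAdelic_JW L a
  -- the raw map `Φ_f ↦ (x ↦ Θ̃_{R_e E(φ_j ⊗ Φ_f)}(charCM χ̃) (ιA x))_j`, linear in `Φ_f`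
  let T : FinSB (↥(maximalRealSubfield L)) (Fin N × Fin 1) →ₗ[ℂ]
      ((adelicGroupData (↥(maximalRealSubfield L)) L (IsCMField.complexConj L) N H).Adelic → (Fin 2 → ℂ)) :=
    { toFun := fun Φf x j =>
        (lineThetaKernelDatum L N e₁ dV hdV hdV0 μ hμ a hρ).thetaLiftFun μW
          (piSBReindex (↥(maximalRealSubfield L)) e₁ (piSchwartzBruhatEquiv (↥(maximalRealSubfield L)) (Fin N × Fin 1) (φ j ⊗ₜ[ℂ] Φf)))
          (charCM (chiQuot (↥(maximalRealSubfield L)) L (IsCMField.complexConj L) (Algebra.IsQuadraticExtension.finrank_eq_two _ L)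
            (IsCMField.complexConj_ne_one (K := L)) a χ))
          ((cmAdelicFrameTransport L N H dV g hg) x)
      map_add' := fun Φf Φf' => funext fun x => funext fun j => by
        simp only [Pi.add_apply]
        exact lineThetaLiftFun_tensor_add L N H e₁ dV hdV hdV0 g hg μ hμ a hρ μW _ (φ j) Φf Φf' x
      map_smul' := fun c Φf => funext fun x => funext fun j => by
        simp only [Pi.smul_apply, smul_eq_mul, RingHom.id_apply]
        exact lineThetaLiftFun_tensor_smul L N H e₁ dV hdV hdV0 g hg μ hμ a hρ μW _ (φ j) c Φf x }
  have hT : ∀ Φf, T Φf = fun x j =>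
      (lineThetaKernelDatum L N e₁ dV hdV hdV0 μ hμ a hρ).thetaLiftFun μW
        (piSBReindex (↥(maximalRealSubfield L)) e₁ (piSchwartzBruhatEquiv (↥(maximalRealSubfield L)) (Fin N × Fin 1) (φ j ⊗ₜ[ℂ] Φf)))
        (charCM (chiQuot (↥(maximalRealSubfield L)) L (IsCMField.complexConj L) (Algebra.IsQuadraticExtension.finrank_eq_two _ L)
          (IsCMField.complexConj_ne_one (K := L)) a χ))
        ((cmAdelicFrameTransport L N H dV g hg) x) := fun _ => rfl
  -- `χ_W`-covariance: `T` kills the relation module of the coinvariants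
  have hcov : ∀ (u : finAdelic (↥(maximalRealSubfield L)) L (IsCMField.complexConj L) 1 (JW (↥(maximalRealSubfield L)) L a))
      (Φf : FinSB (↥(maximalRealSubfield L)) (Fin N × Fin 1)),
      T (finPairRep (↥(maximalRealSubfield L)) L (IsCMField.complexConj L) N 1 e₁ (Matrix.diagonal dV) (JW (↥(maximalRealSubfield L)) L a)
          (complexConj_imagUnit L) (imagUnit_ne_zero L) (imagUnit_mul_self L) (realDiagonal_isSymm L dV hdV) (isSymm_TW (↥(maximalRealSubfield L)) a)
          (isUnit_det_realDiagonal L dV hdV hdV0) (isUnit_det_TW (↥(maximalRealSubfield L)) a) (realDiagonal_map L dV hdV).symm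
          (JW_eq (↥(maximalRealSubfield L)) L a)
          (isCompatible_chiSplittingLine L e₁ dV hdV hdV0 (toHeckeCharacter L μ) (isUnitary_toHeckeCharacter L μ)
            ((isOscillatorChar_toHeckeCharacter_iff μ).mpr hμ) (TW (↥(maximalRealSubfield L)) a) (isSymm_TW (↥(maximalRealSubfield L)) a)
            (isUnit_det_TW (↥(maximalRealSubfield L)) a) (JW (↥(maximalRealSubfield L)) L a) (JW_eq (↥(maximalRealSubfield L)) L a))
          (1, u) Φf) =
        ((lineChar (↥(maximalRealSubfield L)) L (IsCMField.complexConj L) a χ.1 u : ℂˣ) : ℂ) • T Φf := by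
    intro u Φf
    rw [hT, hT]
    funext x j
    simp only [Pi.smul_apply, smul_eq_mul]
    exact lineThetaLiftFun_tensor_finPairRep_one L N H e₁ dV hdV hdV0 g hg μ hμ a hρ μW (φ j) χ u Φf x
  refine ⟨weilCoinvLift (↥(maximalRealSubfield L)) L (IsCMField.complexConj L) N 1 e₁ (Matrix.diagonal dV) (JW (↥(maximalRealSubfield L)) L a)
      (complexConj_imagUnit L) (imagUnit_ne_zero L) (imagUnit_mul_self L) (realDiagonal_isSymm L dV hdV) (isSymm_TW (↥(maximalRealSubfield L)) a)
      (isUnit_det_realDiagonal L dV hdV hdV0) (isUnit_det_TW (↥(maximalRealSubfield L)) a) (realDiagonal_map L dV hdV).symm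
      (JW_eq (↥(maximalRealSubfield L)) L a) (lineChar (↥(maximalRealSubfield L)) L (IsCMField.complexConj L) a χ.1)
      (isCompatible_chiSplittingLine L e₁ dV hdV hdV0 (toHeckeCharacter L μ) (isUnitary_toHeckeCharacter L μ)
        ((isOscillatorChar_toHeckeCharacter_iff μ).mpr hμ) (TW (↥(maximalRealSubfield L)) a) (isSymm_TW (↥(maximalRealSubfield L)) a)
        (isUnit_det_TW (↥(maximalRealSubfield L)) a) (JW (↥(maximalRealSubfield L)) L a) (JW_eq (↥(maximalRealSubfield L)) L a))
      T hcov, fun Φf => rfl, fun k w => ?_⟩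
  -- on generators `mk Φ_f`: `θ (ρ(k) mk Φ_f) = θ (mk (ω_f(ιV k, 1) Φ_f)) = T (ω_f(ιV k, 1) Φ_f)` definitionally
  obtain ⟨Φf, rfl⟩ := TwistedCoinv.mk_surjective _ _ w
  show T (finPairRep (↥(maximalRealSubfield L)) L (IsCMField.complexConj L) N 1 e₁ (Matrix.diagonal dV) (JW (↥(maximalRealSubfield L)) L a)
        (complexConj_imagUnit L) (imagUnit_ne_zero L) (imagUnit_mul_self L) (realDiagonal_isSymm L dV hdV) (isSymm_TW (↥(maximalRealSubfield L)) a)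
        (isUnit_det_realDiagonal L dV hdV hdV0) (isUnit_det_TW (↥(maximalRealSubfield L)) a) (realDiagonal_map L dV hdV).symm
        (JW_eq (↥(maximalRealSubfield L)) L a)
        (isCompatible_chiSplittingLine L e₁ dV hdV hdV0 (toHeckeCharacter L μ) (isUnitary_toHeckeCharacter L μ)
          ((isOscillatorChar_toHeckeCharacter_iff μ).mpr hμ) (TW (↥(maximalRealSubfield L)) a) (isSymm_TW (↥(maximalRealSubfield L)) a)
          (isUnit_det_TW (↥(maximalRealSubfield L)) a) (JW (↥(maximalRealSubfield L)) L a) (JW_eq (↥(maximalRealSubfield L)) L a))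
        ((finPart (↥(maximalRealSubfield L)) L (IsCMField.complexConj L) N (Matrix.diagonal dV)
          (cmAdelicFrameTransport L N H dV g hg (finAdelicToAdelic (↥(maximalRealSubfield L)) L (IsCMField.complexConj L) N H k))), 1) Φf) =
      fun x => T Φf (x * finAdelicToAdelic (↥(maximalRealSubfield L)) L (IsCMField.complexConj L) N H k)
  rw [hT, hT]
  funext x j
  exact (lineThetaLiftFun_tensor_transport_mul_right L N H e₁ dV hdV hdV0 g hg μ hμ a hρ μW _ (φ j) Φf x k).symm

end Summit.HodgeConjecture.HodgeConjecture.Cruxes.H413.F0P2sThetaFunIntertwiner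

end
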